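import Summits.HodgeConjecture.HodgeConjecture.Theorems.LinearSystemTorelliLocalTubeSpanFrameLiftBasic
import Summits.HodgeConjecture.HodgeConjecture.Theorems.LinearSystemTorelliLocalTubeSpanPlaneCalculus

/-!
# Route LinearSystemTorelli — crux `LocalTubeSpan` (stmt-HodgeConjecture-2490): Euclid in a unimodular pencil

Helper file (`--supports stmt-HodgeConjecture-2490`, line `Sketch` of the crux chain, cycle 8,
continuation lead c7; the lead's stub `stub_planeEuclid`, worker A1): the Euclid step of Janssen's
Lemma 2.7 ([Schnell2010] §7, proof of Lemma 11).

For an alternating form `B` on a `ℚ`-vector space `V`, a unimodular pair `⟨u, w⟩ = B u w = 1`,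
and two group elements `tu, tw` acting (through `ρ : G →* End V`) as the transvections
`T_u v = v - B(v, u) u`, `T_w v = v - B(v, w) w`: every vector `ε` whose pairings `b = B u ε`,
`c = B w ε` are integers is moved into `u^⊥` by an element of the group `⟨tu, tw⟩`.

The four Euclidean moves on the pair of pairings `(b, c) = (B u ε, B w ε)` are
`T_w : (b, c) ↦ (b + c, c)`, `T_w⁻¹ : (b, c) ↦ (b - c, c)`, `T_u : (b, c) ↦ (b, c - b)`,
`T_u⁻¹ : (b, c) ↦ (b, c + b)` (`localTubeSpan_planeEuclid_pairing_*`); a strong induction on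
`|b| + |c|` reaches `b = 0` (`b = 0`: the identity; `c = 0 ≠ b`: `T_w⁻¹ T_u⁻¹`,
`(b, 0) ↦ (b, b) ↦ (0, b)`; both non-zero: one of the four moves strictly decreases `|b| + |c|`,
and if `g` kills `B u (t ε)` then `g t` kills `B u ε`).

* `localTubeSpan_planeEuclid_rep` — the statement for any representation `ρ : G →* End V`;
* `localTubeSpan_planeEuclid` — the registered stub: `G = (End V)ˣ`, `ρ` the coercion.

Mathlib only (`omega` on `Int.natAbs`) + `localTubeSpan_inv_transvection_formula`; no named facts;
no `sorry`.
-/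

-- `Summit.HodgeConjecture.HodgeConjecture.Theorems` is the mandated namespace (single-conjunct summit:
-- Sub = Summit), which `linter.dupNamespace` flags on every declaration; the lakefile turns the
-- linter off tree-wide (weak option), restated here so stand-alone elaboration is warning-free too.
set_option linter.dupNamespace false

noncomputable section

open Literature.AlgebraicGeometry.HodgeTheory

namespace Summit.HodgeConjecture.HodgeConjecture.Theorems

/-! ### The four Euclidean moves on the pairings of a unimodular pencil -/

section PlaneEuclidRep

variable {G : Type*} [Group G] {V : Type*} [AddCommGroup V] [Module ℚ V]
  (ρ : G →* (V →ₗ[ℚ] V)) (B : LinearMap.BilinForm ℚ V)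

/-- Pairings after a transvection: if `t` acts as `T_a v = v - B(v, a) a`, then
`B y (t x) = B y x - B x a * B y a`. [folklore] -/
theorem localTubeSpan_planeEuclid_pairing_move (t : G) (a : V) (ht : ∀ v, ρ t v = v - B v a • a)
    (y x : V) : B y (ρ t x) = B y x - B x a * B y a := by
  rw [ht, map_sub, map_smul, smul_eq_mul]

/-- Pairings after an inverse transvection of an alternating form: if `t` acts as
`T_a v = v - B(v, a) a`, then `B y (t⁻¹ x) = B y x + B x a * B y a`. [folklore] -/
theorem localTubeSpan_planeEuclid_pairing_inv_move (hB : B.IsAlt) (t : G) (a : V)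
    (ht : ∀ v, ρ t v = v - B v a • a) (y x : V) : B y (ρ t⁻¹ x) = B y x + B x a * B y a := by
  rw [localTubeSpan_inv_transvection_formula ρ B hB t a ht, map_add, map_smul, smul_eq_mul]

/-- **Euclid in a unimodular pencil** (representation form).  Let `B` be alternating, `B u w = 1`,
and let `tu, tw ∈ G` act through `ρ` as the transvections `T_u`, `T_w`.  Then every `ε` with
integral pairings `B u ε`, `B w ε` is moved into `u^⊥` by some element of `⟨tu, tw⟩`: Euclid's
algorithm on `(B u ε, B w ε)` with the moves `T_w^{±1} : (b, c) ↦ (b ± c, c)`,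
`T_u^{±1} : (b, c) ↦ (b, c ∓ b)`. [folklore] -/
theorem localTubeSpan_planeEuclid_rep (hB : B.IsAlt) {u w : V} (huw : B u w = 1) (tu tw : G)
    (htu : ∀ v, ρ tu v = v - B v u • u) (htw : ∀ v, ρ tw v = v - B v w • w)
    (ε : V) (hb : ∃ b : ℤ, B u ε = b) (hc : ∃ c : ℤ, B w ε = c) :
    ∃ g ∈ Subgroup.closure ({tu, tw} : Set G), B u (ρ g ε) = 0 := by
  obtain ⟨b, hb⟩ := hb
  obtain ⟨c, hc⟩ := hc
  have htuH : tu ∈ Subgroup.closure ({tu, tw} : Set G) :=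
    Subgroup.subset_closure (Set.mem_insert tu {tw})
  have htwH : tw ∈ Subgroup.closure ({tu, tw} : Set G) :=
    Subgroup.subset_closure (Set.mem_insert_of_mem tu (Set.mem_singleton tw))
  have hwu : B w u = -1 := by rw [← hB.neg_eq, huw]
  -- the four moves (and their trivial companions) on the pairings `(B u x, B w x)`
  have hu_tw : ∀ x, B u (ρ tw x) = B u x + B w x := fun x => by
    rw [localTubeSpan_planeEuclid_pairing_move ρ B tw w htw, huw, mul_one, ← hB.neg_eq x w,
      ← sub_eq_add_neg]
  have hw_tw : ∀ x, B w (ρ tw x) = B w x := fun x => by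
    rw [localTubeSpan_planeEuclid_pairing_move ρ B tw w htw, hB.self_eq_zero w, mul_zero, sub_zero]
  have hu_twi : ∀ x, B u (ρ tw⁻¹ x) = B u x - B w x := fun x => by
    rw [localTubeSpan_planeEuclid_pairing_inv_move ρ B hB tw w htw, huw, mul_one, ← hB.neg_eq x w,
      sub_neg_eq_add]
  have hw_twi : ∀ x, B w (ρ tw⁻¹ x) = B w x := fun x => by
    rw [localTubeSpan_planeEuclid_pairing_inv_move ρ B hB tw w htw, hB.self_eq_zero w, mul_zero,
      add_zero]
  have hu_tu : ∀ x, B u (ρ tu x) = B u x := fun x => by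
    rw [localTubeSpan_planeEuclid_pairing_move ρ B tu u htu, hB.self_eq_zero u, mul_zero, sub_zero]
  have hw_tu : ∀ x, B w (ρ tu x) = B w x - B u x := fun x => by
    rw [localTubeSpan_planeEuclid_pairing_move ρ B tu u htu, hwu, mul_neg, mul_one, ← hB.neg_eq x u]
  have hu_tui : ∀ x, B u (ρ tu⁻¹ x) = B u x := fun x => by
    rw [localTubeSpan_planeEuclid_pairing_inv_move ρ B hB tu u htu, hB.self_eq_zero u, mul_zero,
      add_zero]
  have hw_tui : ∀ x, B w (ρ tu⁻¹ x) = B w x + B u x := fun x => by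
    rw [localTubeSpan_planeEuclid_pairing_inv_move ρ B hB tu u htu, hwu, mul_neg, mul_one,
      ← hB.neg_eq x u]
  -- if `g` moves `t ε` into `u^⊥` then `g t` moves `ε` into `u^⊥`
  have step : ∀ {t : G}, t ∈ Subgroup.closure ({tu, tw} : Set G) → ∀ {x : V},
      (∃ g ∈ Subgroup.closure ({tu, tw} : Set G), B u (ρ g (ρ t x)) = 0) →
      ∃ g ∈ Subgroup.closure ({tu, tw} : Set G), B u (ρ g x) = 0 := by
    rintro t ht x ⟨g, hg, h0⟩
    exact ⟨g * t, mul_mem hg ht, by rwa [map_mul, Module.End.mul_apply]⟩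
  -- Euclid: strong induction on `|b| + |c|`
  induction hN : b.natAbs + c.natAbs using Nat.strong_induction_on generalizing b c ε with
  | h N ih =>
  rcases eq_or_ne b 0 with rfl | hb0
  · exact ⟨1, one_mem _, by rw [map_one, Module.End.one_apply, hb, Int.cast_zero]⟩
  rcases eq_or_ne c 0 with rfl | hc0
  · -- `(b, 0) ↦ (b, b) ↦ (0, b)` by `T_u⁻¹` then `T_w⁻¹`
    refine ⟨tw⁻¹ * tu⁻¹, mul_mem (inv_mem htwH) (inv_mem htuH), ?_⟩
    rw [map_mul, Module.End.mul_apply, hu_twi, hu_tui, hw_tui, hc, Int.cast_zero, zero_add,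
      sub_self]
  rcases le_or_gt c.natAbs b.natAbs with hle | hlt
  · -- `0 < |c| ≤ |b|`: decrease `|b|` by `T_w` or `T_w⁻¹`
    rcases (show (b + c).natAbs + c.natAbs < N ∨ (b - c).natAbs + c.natAbs < N by omega)
      with h1 | h1
    · refine step htwH (ih _ h1 (ρ tw ε) (b + c) ?_ c ?_ rfl)
      · rw [hu_tw, hb, hc, Int.cast_add]
      · rw [hw_tw, hc]
    · refine step (inv_mem htwH) (ih _ h1 (ρ tw⁻¹ ε) (b - c) ?_ c ?_ rfl)
      · rw [hu_twi, hb, hc, Int.cast_sub]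
      · rw [hw_twi, hc]
  · -- `0 < |b| < |c|`: decrease `|c|` by `T_u` or `T_u⁻¹`
    rcases (show b.natAbs + (c - b).natAbs < N ∨ b.natAbs + (c + b).natAbs < N by omega)
      with h1 | h1
    · refine step htuH (ih _ h1 (ρ tu ε) b ?_ (c - b) ?_ rfl)
      · rw [hu_tu, hb]
      · rw [hw_tu, hb, hc, Int.cast_sub]
    · refine step (inv_mem htuH) (ih _ h1 (ρ tu⁻¹ ε) b ?_ (c + b) ?_ rfl)
      · rw [hu_tui, hb]
      · rw [hw_tui, hb, hc, Int.cast_add]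

end PlaneEuclidRep

/-! ### The registered stub: units of `End V` -/

section PlaneEuclid

variable {V : Type} [AddCommGroup V] [Module ℚ V]

/-- **Euclid in a unimodular pencil** (stub `stub_planeEuclid` of line `Sketch`, cycle 8; the Euclid
step of Janssen's Lemma 2.7).  If units `tu, tw` of `End V` act as the transvections `T_u, T_w` of
an alternating form with `⟨u, w⟩ = 1`, then every `ε` with integral pairings `⟨u, ε⟩, ⟨w, ε⟩` is
moved into `u^⊥` by some element of `⟨tu, tw⟩` (`T_w^{±1} : ⟨u, ε⟩ ↦ ⟨u, ε⟩ ± ⟨w, ε⟩`,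
`T_u^{±1} : ⟨w, ε⟩ ↦ ⟨w, ε⟩ ∓ ⟨u, ε⟩`; Euclid on `|⟨u, ε⟩| + |⟨w, ε⟩|`). [folklore] -/
theorem localTubeSpan_planeEuclid (B : LinearMap.BilinForm ℚ V) (hB : B.IsAlt) {u w : V}
    (huw : B u w = 1) (tu tw : (V →ₗ[ℚ] V)ˣ)
    (htu : ∀ v, ((tu : (V →ₗ[ℚ] V)ˣ) : V →ₗ[ℚ] V) v = v - B v u • u)
    (htw : ∀ v, ((tw : (V →ₗ[ℚ] V)ˣ) : V →ₗ[ℚ] V) v = v - B v w • w)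
    (ε : V) (hb : ∃ b : ℤ, B u ε = b) (hc : ∃ c : ℤ, B w ε = c) :
    ∃ g ∈ Subgroup.closure ({tu, tw} : Set (V →ₗ[ℚ] V)ˣ),
      B u (((g : (V →ₗ[ℚ] V)ˣ) : V →ₗ[ℚ] V) ε) = 0 :=
  localTubeSpan_planeEuclid_rep (Units.coeHom (V →ₗ[ℚ] V)) B hB huw tu tw htu htw ε hb hc

end PlaneEuclid

end Summit.HodgeConjecture.HodgeConjecture.Theorems

end
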